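/-
Copyright (c) 2026 the pub-hodgecm-mathlib formalisation cell (harness21).  Prover seat hodgecm-mathlib-K2Liu-p14 (g2), Track B «K2-LIT»,
#184♮ = hLiu418 = `stmt-HodgeConjecture-24832`; #42S payer road, organ S4 (glue), brick (N2-arch) of LEAD F0P6-plan (g14) RULING «M-158c» (THE SCALAR ROAD;
«(S4-arch) SHRINKS to: positive real scalars act by right translation»), real-place twin of ★ (N2) `K2LiuLocalSWImageNormScalar`.
-/
import Summits.HodgeConjecture.HodgeConjecture.Theorems.K2LiuArchInducedTubeDefs   -- ★ D∞ (K2Liu-p11): `IsArchSiegelSection`; ★ H1-A∕B tube-frame block calculus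
import HarnessLib

/-!
# Crux `HLiu418`, #42S organ S4, brick (N2-arch): IN THE TUBE FRAME `U(J)`, CONJUGATION BY THE SIMILITUDE `d_a = diag(1, a·1)` (`a > 0`) IS INNER BY THE
# LEVI SCALAR `m_a = diag(a^{−1∕2}·1, a^{1∕2}·1) ∈ U(J) ∩ P_Δ`, SO `f ↦ f ∘ Ad(d_a)` IS A CONSTANT TIMES A RIGHT TRANSLATION ON ARCH SIEGEL SECTIONS —
# «POSITIVE REAL SCALARS ACT BY RIGHT TRANSLATION»

Cell `hodgecm-mathlib`, crux item hLiu418 = `stmt-HodgeConjecture-24832`; squad K2 ∕ K2Liu; LEAD F0P6-plan (g14), co-dealer K2E5-plan (g7); prover K2Liu-p14 (g2).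
THEOREMS ONLY (no `def`, no instance, no notation, no named-fact hypothesis, no `sorry`); lane `--supports stmt-HodgeConjecture-24832 --as helper`.

SETTING = ★ D∞ `K2LiuArchInducedTubeDefs` (the currency of record for `I_w(s, χ_w)` at a complex place, K2E5-plan 08:24:53Z): `U(J) = {g | gᴴ J g = J}`,
`J = Matrix.J l ℂ = (0 −1; 1 0)`, Siegel parabolic `P_Δ = {g₂₁ = 0}` with Levi block `A_g = g₁₁`, arch Siegel sections `IsArchSiegelSection χ s f`:
`f (p g) = χ(det A_p) · ‖det A_p‖^{2s+l} · f g` for `p ∈ U(J) ∩ P_Δ`.  For a real `a > 0` the diagonal matrix `d_a = diag(1, a·1)` is a SIMILITUDE of `J`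
(`d_aᴴ J d_a = a · J`, `conjTranspose_diag_mul_J_mul_diag`) — the real-place face of the rational scaling `dV′ ↦ a • dV′` of an auxiliary hermitian frame
with `σ_w(a) > 0` — and, `a = r²` being a norm from `ℂ` (`r = √a`), `d_a = r · m_a` with `m_a = diag(r⁻¹·1, r·1) ∈ U(J) ∩ P_Δ` (§1).  Hence (§2) for an arch
Siegel section `f`: `f(d_a g d_a⁻¹) = f(m_a g m_a⁻¹) = χ(r^{−l}) · r^{−l(2 re s + l)}… · f(g m_a⁻¹)` — a constant times a RIGHT translate — and (§3) every
right-`U(J)`-stable space `R` of arch Siegel sections satisfies `R.map (f ↦ f ∘ Ad(d_a)) = R` (the arch local Siegel–Weil images `R_∞(dV′, w)` of the S2 organ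
are such spaces; that instance is S2's, not typed here).
* §1 `leviScalar_mul_leviScalar'` (`m_a m_a′ = 1`), `conjTranspose_leviScalar_mul_J_mul` (`m_a ∈ U(J)`), `toBlocks₂₁_leviScalar`, `toBlocks₁₁_leviScalar`,
  `conjTranspose_diag_mul_J_mul_diag` (similitude), **`diag_conj_eq_levi_conj`** (`d_a g d_a⁻¹ = m_a g m_a′`, both `= [[A, a⁻¹B], [aC, D]]`).
* §2 **`apply_diag_conj_of_isArchSiegelSection`**.
* §3 `dOne_mul_dOne_conj_mul_dOne`, `diag_conj_mem_of_mem`, **`diag_conj_mem_iff`**, **`map_funLeft_diag_conj_eq`**, `comap_funLeft_diag_conj_eq`.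
References: [Shimura1997, §5.1, §16 (the tube realisation of `U(n,n)` and its degenerate principal series)]; [MoeglinVignerasWaldspurger1987, Chap. 1 I.17
(similitudes with norm multiplier are inner up to the centre)]; [Kudla1994, §3]; [HarrisKudlaSweet1996, §1 (1.15)].
HONEST LABEL.  Count-neutral helper: `HC_CM` is proved only modulo the 7 printed citations (2 remaining named inputs: hLiu418 = `stmt-HodgeConjecture-24832`,
h413 = `stmt-HodgeConjecture-24833`) until rung 0 closes.
-/

set_option autoImplicit false
set_option linter.dupNamespace false -- the mandated namespace repeats `HodgeConjecture.HodgeConjecture`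

noncomputable section

open scoped Matrix
open Matrix Complex
open Summit.HodgeConjecture.HodgeConjecture.Cruxes.HLiu418.K2LiuHermitianTubeCocycle
open Summit.HodgeConjecture.HodgeConjecture.Cruxes.HLiu418.K2LiuArchInducedTubeDefs

namespace Summit.HodgeConjecture.HodgeConjecture.Cruxes.HLiu418.K2LiuArchSiegelSectionNormScalar

variable {l : Type*} [Fintype l] [DecidableEq l]

/-! ## §1 The Levi scalar `m_a = diag(r⁻¹·1, r·1)`, `r = √a`, and `Ad(d_a) = Ad(m_a)` -/

/-- `(x·1)(y·1) = (xy)·1`-type product of two scalar block-diagonal matrices. [folklore] -/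
theorem diag_mul_diag (x y x' y' : ℂ) :
    (fromBlocks (x • (1 : Matrix l l ℂ)) 0 0 (y • (1 : Matrix l l ℂ))) * fromBlocks (x' • (1 : Matrix l l ℂ)) 0 0 (y' • (1 : Matrix l l ℂ)) =
      fromBlocks ((x * x') • (1 : Matrix l l ℂ)) 0 0 ((y * y') • (1 : Matrix l l ℂ)) := by
  rw [fromBlocks_multiply]
  simp only [Matrix.smul_mul, Matrix.mul_smul, Matrix.one_mul, Matrix.mul_zero, Matrix.zero_mul, add_zero, zero_add, smul_zero, smul_smul]
  rw [mul_comm x' x, mul_comm y' y]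

/-- `d_x · d_y = d_{xy}` for `d_x = diag(1, x·1)`. [folklore] -/
theorem dOne_mul_dOne (x y : ℂ) :
    (fromBlocks (1 : Matrix l l ℂ) 0 0 (x • (1 : Matrix l l ℂ))) * fromBlocks (1 : Matrix l l ℂ) 0 0 (y • (1 : Matrix l l ℂ)) =
      fromBlocks (1 : Matrix l l ℂ) 0 0 ((x * y) • (1 : Matrix l l ℂ)) := by
  rw [fromBlocks_multiply]
  simp only [Matrix.smul_mul, Matrix.mul_smul, Matrix.one_mul, Matrix.mul_zero, Matrix.zero_mul, add_zero, zero_add, smul_zero, smul_smul]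
  rw [mul_comm y x]

/-- `d_a (d_b g d_c) d_d = g` when `a b = 1 = c d` (`Ad(d_{a}) ∘ Ad(d_{b})` cancels). [folklore] -/
theorem dOne_mul_dOne_conj_mul_dOne {a b c d : ℂ} (hab : a * b = 1) (hcd : c * d = 1) (g : Matrix (l ⊕ l) (l ⊕ l) ℂ) :
    fromBlocks (1 : Matrix l l ℂ) 0 0 (a • (1 : Matrix l l ℂ)) *
        (fromBlocks (1 : Matrix l l ℂ) 0 0 (b • (1 : Matrix l l ℂ)) * g * fromBlocks (1 : Matrix l l ℂ) 0 0 (c • (1 : Matrix l l ℂ))) *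
        fromBlocks (1 : Matrix l l ℂ) 0 0 (d • (1 : Matrix l l ℂ)) = g := by
  calc _ = (fromBlocks (1 : Matrix l l ℂ) 0 0 (a • (1 : Matrix l l ℂ)) * fromBlocks (1 : Matrix l l ℂ) 0 0 (b • (1 : Matrix l l ℂ))) * g *
        (fromBlocks (1 : Matrix l l ℂ) 0 0 (c • (1 : Matrix l l ℂ)) * fromBlocks (1 : Matrix l l ℂ) 0 0 (d • (1 : Matrix l l ℂ))) := by
          simp only [Matrix.mul_assoc]
    _ = g := by rw [dOne_mul_dOne, dOne_mul_dOne, hab, hcd, one_smul, fromBlocks_one, Matrix.one_mul, Matrix.mul_one]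

/-- **`m_a · m_a′ = 1`** for `m_a = diag(r⁻¹·1, r·1)`, `m_a′ = diag(r·1, r⁻¹·1)`, `r ≠ 0`. [cite: Shimura1997, §5.1] -/
theorem leviScalar_mul_leviScalar' {r : ℂ} (hr : r ≠ 0) :
    (fromBlocks (r⁻¹ • (1 : Matrix l l ℂ)) 0 0 (r • (1 : Matrix l l ℂ))) * fromBlocks (r • (1 : Matrix l l ℂ)) 0 0 (r⁻¹ • (1 : Matrix l l ℂ)) = 1 := by
  rw [diag_mul_diag, inv_mul_cancel₀ hr, mul_inv_cancel₀ hr, one_smul, fromBlocks_one]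

/-- **`m_a′ · m_a = 1`**. [cite: Shimura1997, §5.1] -/
theorem leviScalar'_mul_leviScalar {r : ℂ} (hr : r ≠ 0) :
    (fromBlocks (r • (1 : Matrix l l ℂ)) 0 0 (r⁻¹ • (1 : Matrix l l ℂ))) * fromBlocks (r⁻¹ • (1 : Matrix l l ℂ)) 0 0 (r • (1 : Matrix l l ℂ)) = 1 := by
  rw [diag_mul_diag, inv_mul_cancel₀ hr, mul_inv_cancel₀ hr, one_smul, fromBlocks_one]

/-- **`m_a ∈ U(J)`** for REAL `r ≠ 0`: `(r⁻¹·1)ᴴ (r·1) = 1`. [cite: Shimura1997, §5.1] -/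
theorem conjTranspose_leviScalar_mul_J_mul {r : ℝ} (hr : r ≠ 0) :
    (fromBlocks (((r : ℂ))⁻¹ • (1 : Matrix l l ℂ)) 0 0 ((r : ℂ) • (1 : Matrix l l ℂ)))ᴴ * Matrix.J l ℂ *
        fromBlocks (((r : ℂ))⁻¹ • (1 : Matrix l l ℂ)) 0 0 ((r : ℂ) • (1 : Matrix l l ℂ)) = Matrix.J l ℂ := by
  rw [levi_mem_iff, conjTranspose_smul, conjTranspose_one, Matrix.smul_mul, Matrix.one_mul, smul_smul, star_inv₀, Complex.star_def, Complex.conj_ofReal,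
    inv_mul_cancel₀ (Complex.ofReal_ne_zero.2 hr), one_smul]

/-- the same for `m_a′ = diag(r·1, r⁻¹·1)`. [cite: Shimura1997, §5.1] -/
theorem conjTranspose_leviScalar'_mul_J_mul {r : ℝ} (hr : r ≠ 0) :
    (fromBlocks ((r : ℂ) • (1 : Matrix l l ℂ)) 0 0 (((r : ℂ))⁻¹ • (1 : Matrix l l ℂ)))ᴴ * Matrix.J l ℂ *
        fromBlocks ((r : ℂ) • (1 : Matrix l l ℂ)) 0 0 (((r : ℂ))⁻¹ • (1 : Matrix l l ℂ)) = Matrix.J l ℂ := by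
  rw [levi_mem_iff, conjTranspose_smul, conjTranspose_one, Matrix.smul_mul, Matrix.one_mul, smul_smul, Complex.star_def, Complex.conj_ofReal,
    mul_inv_cancel₀ (Complex.ofReal_ne_zero.2 hr), one_smul]

omit [Fintype l] [DecidableEq l] in
/-- `m_a ∈ P_Δ`: the lower-left block of a block-diagonal matrix vanishes. [cite: Shimura1997, §5.1] -/
theorem toBlocks₂₁_diag (X Y : Matrix l l ℂ) : (fromBlocks X 0 0 Y).toBlocks₂₁ = 0 :=
  toBlocks_fromBlocks₂₁ _ _ _ _

omit [Fintype l] [DecidableEq l] in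
/-- the Levi block of a block-diagonal matrix. [cite: Shimura1997, §5.1] -/
theorem toBlocks₁₁_diag (X Y : Matrix l l ℂ) : (fromBlocks X 0 0 Y).toBlocks₁₁ = X :=
  toBlocks_fromBlocks₁₁ _ _ _ _

/-- **`d_a = diag(1, a·1)` IS A SIMILITUDE of `J` with multiplier `a`** (`a` real): `d_aᴴ J d_a = a · J`. [cite: MoeglinVignerasWaldspurger1987, Chap. 1 I.17] -/
theorem conjTranspose_diag_mul_J_mul_diag (a : ℝ) :
    (fromBlocks (1 : Matrix l l ℂ) 0 0 ((a : ℂ) • (1 : Matrix l l ℂ)))ᴴ * Matrix.J l ℂ * fromBlocks (1 : Matrix l l ℂ) 0 0 ((a : ℂ) • (1 : Matrix l l ℂ)) =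
      (a : ℂ) • Matrix.J l ℂ := by
  have h : ((a : ℂ) • (1 : Matrix l l ℂ))ᴴ = (a : ℂ) • (1 : Matrix l l ℂ) := by
    rw [conjTranspose_smul, conjTranspose_one, Complex.star_def, Complex.conj_ofReal]
  rw [fromBlocks_conjTranspose_mul_J_mul, Matrix.J, fromBlocks_smul, h]
  simp only [conjTranspose_zero, conjTranspose_one, Matrix.zero_mul, Matrix.mul_zero, Matrix.one_mul, Matrix.mul_one, sub_zero, zero_sub, smul_zero, smul_neg]

/-- **`Ad(d_a) = Ad(m_a)`**: `diag(1, a·1) · g · diag(1, a⁻¹·1) = m_a · g · m_a′ (= [[A, a⁻¹B], [aC, D]])` when `r² = a ≠ 0` — scalars cancel.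
[cite: MoeglinVignerasWaldspurger1987, Chap. 1 I.17] [cite: Kudla1994, §3] -/
theorem diag_conj_eq_levi_conj {a r : ℂ} (hr : r ≠ 0) (hra : r * r = a) (g : Matrix (l ⊕ l) (l ⊕ l) ℂ) :
    fromBlocks (1 : Matrix l l ℂ) 0 0 (a • (1 : Matrix l l ℂ)) * g * fromBlocks (1 : Matrix l l ℂ) 0 0 (a⁻¹ • (1 : Matrix l l ℂ)) =
      fromBlocks (r⁻¹ • (1 : Matrix l l ℂ)) 0 0 (r • (1 : Matrix l l ℂ)) * g * fromBlocks (r • (1 : Matrix l l ℂ)) 0 0 (r⁻¹ • (1 : Matrix l l ℂ)) := by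
  have ha : a ≠ 0 := by rw [← hra]; exact mul_ne_zero hr hr
  conv_lhs => rw [← fromBlocks_toBlocks g]
  conv_rhs => rw [← fromBlocks_toBlocks g]
  rw [fromBlocks_multiply, fromBlocks_multiply, fromBlocks_multiply, fromBlocks_multiply]
  simp only [Matrix.smul_mul, Matrix.mul_smul, Matrix.one_mul, Matrix.mul_one, Matrix.mul_zero, Matrix.zero_mul, add_zero, zero_add, smul_smul,
    inv_mul_cancel₀ hr, mul_inv_cancel₀ hr, inv_mul_cancel₀ ha, one_smul]
  rw [show r * r = a from hra, show r⁻¹ * r⁻¹ = a⁻¹ by rw [← mul_inv, hra]]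

/-! ## §2 Arch Siegel sections: `f ∘ Ad(d_a)` is a constant times a right translate -/

variable (χ : ℂ → ℂ) (s : ℂ)

/-- **POSITIVE REAL SCALARS ACT BY RIGHT TRANSLATION (pointwise form).**  For an arch Siegel section `f` of `I_w(s, χ)` and `a > 0`, `r = √a`:
`f(d_a g d_a⁻¹) = χ(det(r⁻¹·1)) · ‖det(r⁻¹·1)‖^{2s+l} · f(g · m_a′)`, `m_a′ = diag(r·1, r⁻¹·1) = m_a⁻¹`. [cite: Shimura1997, §16] [cite: HarrisKudlaSweet1996, §1 (1.15)]
[cite: MoeglinVignerasWaldspurger1987, Chap. 1 I.17] -/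
theorem apply_diag_conj_of_isArchSiegelSection {f : Matrix (l ⊕ l) (l ⊕ l) ℂ → ℂ} (hf : IsArchSiegelSection χ s f) {a : ℝ} (ha : 0 < a)
    (g : Matrix (l ⊕ l) (l ⊕ l) ℂ) :
    f (fromBlocks (1 : Matrix l l ℂ) 0 0 ((a : ℂ) • (1 : Matrix l l ℂ)) * g * fromBlocks (1 : Matrix l l ℂ) 0 0 (((a : ℂ))⁻¹ • (1 : Matrix l l ℂ))) =
      χ (((Real.sqrt a : ℂ))⁻¹ • (1 : Matrix l l ℂ)).det * (((‖(((Real.sqrt a : ℂ))⁻¹ • (1 : Matrix l l ℂ)).det‖ : ℝ) : ℂ) ^ (2 * s + (Fintype.card l : ℂ))) *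
        f (g * fromBlocks ((Real.sqrt a : ℂ) • (1 : Matrix l l ℂ)) 0 0 (((Real.sqrt a : ℂ))⁻¹ • (1 : Matrix l l ℂ))) := by
  have hr0 : Real.sqrt a ≠ 0 := (Real.sqrt_pos.2 ha).ne'
  have hr : (Real.sqrt a : ℂ) ≠ 0 := Complex.ofReal_ne_zero.2 hr0
  have hra : (Real.sqrt a : ℂ) * (Real.sqrt a : ℂ) = (a : ℂ) := by rw [← Complex.ofReal_mul, Real.mul_self_sqrt ha.le]
  rw [diag_conj_eq_levi_conj hr hra, Matrix.mul_assoc,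
    hf _ _ (conjTranspose_leviScalar_mul_J_mul hr0) (toBlocks₂₁_diag _ _), toBlocks₁₁_diag]

/-! ## §3 Right-`U(J)`-stable spaces of arch Siegel sections are `Ad(d_a)`-stable -/

variable (R : Submodule ℂ (Matrix (l ⊕ l) (l ⊕ l) ℂ → ℂ))
  (hsec : ∀ f ∈ R, IsArchSiegelSection χ s f)
  (hright : ∀ f ∈ R, ∀ k : Matrix (l ⊕ l) (l ⊕ l) ℂ, kᴴ * Matrix.J l ℂ * k = Matrix.J l ℂ → (fun g => f (g * k)) ∈ R)

include hsec hright in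
/-- `f ∈ R ⇒ f ∘ Ad(d_a) ∈ R` for `a > 0`. [cite: Shimura1997, §16] [cite: HarrisKudlaSweet1996, §1 (1.15)] -/
theorem diag_conj_mem_of_mem {a : ℝ} (ha : 0 < a) {f : Matrix (l ⊕ l) (l ⊕ l) ℂ → ℂ} (hf : f ∈ R) :
    (fun g => f (fromBlocks (1 : Matrix l l ℂ) 0 0 ((a : ℂ) • (1 : Matrix l l ℂ)) * g * fromBlocks (1 : Matrix l l ℂ) 0 0 (((a : ℂ))⁻¹ • (1 : Matrix l l ℂ)))) ∈ R := by
  have hr0 : Real.sqrt a ≠ 0 := (Real.sqrt_pos.2 ha).ne'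
  have hfun : (fun g => f (fromBlocks (1 : Matrix l l ℂ) 0 0 ((a : ℂ) • (1 : Matrix l l ℂ)) * g * fromBlocks (1 : Matrix l l ℂ) 0 0 (((a : ℂ))⁻¹ • (1 : Matrix l l ℂ)))) =
      (χ (((Real.sqrt a : ℂ))⁻¹ • (1 : Matrix l l ℂ)).det * (((‖(((Real.sqrt a : ℂ))⁻¹ • (1 : Matrix l l ℂ)).det‖ : ℝ) : ℂ) ^ (2 * s + (Fintype.card l : ℂ)))) •
        fun g => f (g * fromBlocks ((Real.sqrt a : ℂ) • (1 : Matrix l l ℂ)) 0 0 (((Real.sqrt a : ℂ))⁻¹ • (1 : Matrix l l ℂ))) := by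
    funext g
    rw [Pi.smul_apply, smul_eq_mul, apply_diag_conj_of_isArchSiegelSection χ s (hsec f hf) ha]
  rw [hfun]
  exact R.smul_mem _ (hright f hf _ (conjTranspose_leviScalar'_mul_J_mul hr0))

include hsec hright in
/-- **`f ∘ Ad(d_a) ∈ R ↔ f ∈ R`** (`a > 0`) for a right-`U(J)`-stable space `R` of arch Siegel sections. [cite: Shimura1997, §16] [cite: HarrisKudlaSweet1996, §1 (1.15)] -/
theorem diag_conj_mem_iff {a : ℝ} (ha : 0 < a) (f : Matrix (l ⊕ l) (l ⊕ l) ℂ → ℂ) :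
    (fun g => f (fromBlocks (1 : Matrix l l ℂ) 0 0 ((a : ℂ) • (1 : Matrix l l ℂ)) * g * fromBlocks (1 : Matrix l l ℂ) 0 0 (((a : ℂ))⁻¹ • (1 : Matrix l l ℂ)))) ∈ R ↔
      f ∈ R := by
  refine ⟨fun hf => ?_, diag_conj_mem_of_mem χ s R hsec hright ha⟩
  have ha0 : (a : ℂ) ≠ 0 := Complex.ofReal_ne_zero.2 ha.ne'
  have key := diag_conj_mem_of_mem χ s R hsec hright (inv_pos.2 ha) hf
  convert key using 2
  rename_i g
  rw [Complex.ofReal_inv]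
  exact (congrArg f (dOne_mul_dOne_conj_mul_dOne (l := l) (mul_inv_cancel₀ ha0) (by rw [inv_inv]; exact mul_inv_cancel₀ ha0) g)).symm

include hsec hright in
/-- **«POSITIVE REAL SCALARS ACT BY RIGHT TRANSLATION»: `R.map (f ↦ f ∘ Ad(d_a)) = R`** for `a > 0` and every right-`U(J)`-stable space `R` of arch Siegel
sections (`Ad(d_a)` as the linear map ★ `LinearMap.funLeft ℂ ℂ (g ↦ d_a g d_a⁻¹)`). [cite: Shimura1997, §16] [cite: MoeglinVignerasWaldspurger1987, Chap. 1 I.17]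
[cite: HarrisKudlaSweet1996, §1 (1.15)] -/
theorem map_funLeft_diag_conj_eq {a : ℝ} (ha : 0 < a) :
    R.map (LinearMap.funLeft ℂ ℂ fun g : Matrix (l ⊕ l) (l ⊕ l) ℂ =>
        fromBlocks (1 : Matrix l l ℂ) 0 0 ((a : ℂ) • (1 : Matrix l l ℂ)) * g * fromBlocks (1 : Matrix l l ℂ) 0 0 (((a : ℂ))⁻¹ • (1 : Matrix l l ℂ))) = R := by
  have ha0 : (a : ℂ) ≠ 0 := Complex.ofReal_ne_zero.2 ha.ne'
  have hiff := diag_conj_mem_iff χ s R hsec hright ha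
  refine le_antisymm ?_ fun f hf => ?_
  · rintro _ ⟨g, hg, rfl⟩
    exact (hiff g).2 hg
  · -- `f = (f ∘ Ad(d_{a⁻¹})) ∘ Ad(d_a)` and `f ∘ Ad(d_{a⁻¹}) ∈ R`
    have hmem := diag_conj_mem_of_mem χ s R hsec hright (inv_pos.2 ha) hf
    refine ⟨_, hmem, ?_⟩
    funext g
    rw [LinearMap.funLeft_apply]
    simp only [Complex.ofReal_inv]
    exact congrArg f (dOne_mul_dOne_conj_mul_dOne (l := l) (inv_mul_cancel₀ ha0) (mul_inv_cancel₀ (inv_ne_zero ha0)) g)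

include hsec hright in
/-- the `comap` form: `R.comap (f ↦ f ∘ Ad(d_a)) = R`. [cite: Shimura1997, §16] -/
theorem comap_funLeft_diag_conj_eq {a : ℝ} (ha : 0 < a) :
    R.comap (LinearMap.funLeft ℂ ℂ fun g : Matrix (l ⊕ l) (l ⊕ l) ℂ =>
        fromBlocks (1 : Matrix l l ℂ) 0 0 ((a : ℂ) • (1 : Matrix l l ℂ)) * g * fromBlocks (1 : Matrix l l ℂ) 0 0 (((a : ℂ))⁻¹ • (1 : Matrix l l ℂ))) = R := by
  ext f
  rw [Submodule.mem_comap]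
  exact diag_conj_mem_iff χ s R hsec hright ha f

end Summit.HodgeConjecture.HodgeConjecture.Cruxes.HLiu418.K2LiuArchSiegelSectionNormScalar

end
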